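import Mathlib
import Summits.NavierStokesRegularity.NavierStokesRegularity.Theorems.L3TimeExponentPincerJawFullMorreyHolds
import Summits.NavierStokesRegularity.NavierStokesRegularity.Theorems.L3TimeExponentPincerEffSatBlowupStubParabolicConcentrationBlowup
import HarnessLib.Audit
import HarnessLib

/-!
# `K₃(1)` at MOST late times on the scaled-energy-Type-I (full-Morrey) class: the `L³`-fast set is log-null
# (route `L3TimeExponentPincer`, child crux `stmt-NavierStokesRegularity-19139` EffSatBlowup, line `pace`;
# parent `stmt-NavierStokesRegularity-19499`; support file 7 of seat p4)

Support file (cell ns-regularity-ideate, seat p4, gen 5).  0 `sorry`, no definitions.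

Fix a frame solution `u` (classical on `[0,T)`, Leray–Hopf from `u 0`) and a threshold `A > 0`.  Call a time
`t < T` **`L³`-fast** (at level `A`) when `‖u(t)‖₃³ > A/√(T-t)`, i.e. when the `L³`-Type-I pace inequality of
`L3TimeExponentPincerPaceDichotomy.L3Slow` FAILS at `t`; the fast set is written out as
`{t | ENNReal.ofReal (A / √(T-t)) < eLpNorm (u t) 3 volume ^ 3}` throughout (no new definition).

* §0  `aemeasurable_l3cube_of_frame` — `t ↦ ‖u(t)‖₃³` is a.e.-measurable on `(0,T)` (joint continuity +
  Tonelli), so the fast set is null-measurable on every `(T₂,T)`, `0 ≤ T₂`.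
* §1  `lintegral_indicator_fast_le` — pure bookkeeping: `∫_{fast ∩ (T₂,T)} A²/(T-t) dt ≤ ∫_{T₂}^{T} ‖u(t)‖₃⁶ dt`
  (at a fast time `A²/(T-t) < ‖u(t)‖₃⁶`).
* §2  **log-nullity** `lintegral_fast_inv_sub_lt_top_of_fullMorrey` — on the full-Morrey class
  (`FullMorreyTypeINear`: `∫_{B(x₀,r)}|u(t)|² ≤ M r` for all late `t`, all centres, all `r < r₁`) THEOREM J′
  (`…JawFullMorreyHolds.lintegral_six_lt_top_holds`, unconditional) gives `∫^{T} ‖u‖₃⁶ < ∞`, hence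
  `∫_{fast} dt/(T-t) < ∞` for EVERY `A > 0`: the fast set is null for the logarithmic measure `dt/(T-t)`.
* §3  **density zero** `fastSet_density_zero_of_fullMorrey` — consequently `|fast ∩ (T-h,T)| ≤ ε h` for all
  `h < h₀(ε)`: the fast set has density `0` at `T` (the sequential statement
  `…FullMorreySequentialPace.exists_late_l3Slow_of_fullMorrey`, `liminf √(T-t)‖u(t)‖₃³ = 0`, is its weak shadow).
* §4  `fatClauseAt_offFast_of_blowup` — for EVERY frame blow-up (no Morrey hypothesis) the crux clause
  `FatClauseAt (γ/(A²c³)) (c/A) 1 u T t` of `EffSatBlowup` holds at every late time that is NOT fast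
  (registered stub 1 `…Cruxes.EffSatBlowup.Pace.stub_parabolicConcentration_blowup`, landed p423422, fed into the
  one-time slow slice `fatClauseAt_of_parabolic_of_slow`).
* §5  **headline** `effSat_mostTimes_of_fullMorrey` — a frame blow-up that is full-Morrey-Type-I near `T`
  satisfies the `K₃(1)` clause with FIXED constants at every late time outside a log-null (hence density-`0`)
  set of times.  On the scaled-energy-Type-I class the open content of the child crux (`FastTimesFatB`, stub 3's
  residue there) lives on a set of times of logarithmic measure `< ∞`.
* §6  `dissip_fast_of_l3Fast_of_fullMorrey` — on the same class every `L³`-fast time is DISSIPATION-fast: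
  `A²/(T-t) < D · ∫|∇u(t)|²` with one `D < ∞` (J′'s slice inequality `(∫|u|³)² ≤ D ∫|∇u|²`); i.e. the fast set
  sits inside the set of times of super-Leray dissipation `δ(t) ≳ (T-t)^{-1}` (Leray's floor is `(T-t)^{-1/2}`).

Bearing: stub 2 of line `pace` (`stub_morreyTypeI_slow`) asks for the UNIFORM pace `L3Slow` (empty fast set for
some `A`) on the larger top-at-`T` class `MorreyTypeINear`; this file gives, on the full-Morrey sub-class, the
clause at all late times but a log-null set, for every `A`.  WHAT THIS IS NOT: not a claim about Navier–Stokes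
regularity; not stub 2 (uniform) and not the crux; no item or stub is closed.
References: THEOREM J′ (nsreg-p2 ROUND-9; Maz'ya-free form nsreg-p4 g4); K. Kang, H. Miura, T.-P. Tsai,
arXiv:2006.13145 Thm 1.6(i) (stub 1); T. Barker, C. Prange, arXiv:1812.09115 (1.7).
-/

noncomputable section

namespace Summit.NavierStokesRegularity.NavierStokesRegularity.Theorems.L3TimeExponentPincerFullMorreyMostTimes

open MeasureTheory Set Function Filter Metric Topology
open scoped ENNReal NNReal
open Literature.Analysis.FluidPDE
open Summit.NavierStokesRegularity.NavierStokesRegularity.Theorems.L3TimeExponentPincerJawFullMorrey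
  (FullMorreyTypeINear dissipRate eLpNorm_three_rpow_eq)
open Summit.NavierStokesRegularity.NavierStokesRegularity.Theorems.L3TimeExponentPincerJawFullMorreyHolds
  (lintegral_six_lt_top_holds)
open Summit.NavierStokesRegularity.NavierStokesRegularity.Theorems.L3TimeExponentPincerPaceDichotomy
  (FatClauseAt fatClauseAt_of_parabolic_of_slow)
open Summit.NavierStokesRegularity.NavierStokesRegularity.Cruxes.EffSatBlowup.Pace
  (stub_parabolicConcentration_blowup)

/-! ## §0  Measurability of `t ↦ ‖u(t)‖₃³` on the open time slab -/

/-- `‖f‖₃³ = ∫ ‖f‖ₑ³` (the `q = 3` case of `eLpNorm_three_rpow_eq`). -/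
theorem eLpNorm_three_rpow_three_eq {α F : Type*} [MeasurableSpace α] [NormedAddCommGroup F]
    (μ : Measure α) (f : α → F) :
    eLpNorm f 3 μ ^ (3 : ℝ) = ∫⁻ x, ‖f x‖ₑ ^ (3 : ℕ) ∂μ := by
  rw [eLpNorm_three_rpow_eq μ f 3, show (3 : ℝ) / 3 = 1 by norm_num, ENNReal.rpow_one]

/-- `‖f‖₃⁶ = (∫ ‖f‖ₑ³)²` (the `q = 6` case of `eLpNorm_three_rpow_eq`). -/
theorem eLpNorm_three_rpow_six_eq {α F : Type*} [MeasurableSpace α] [NormedAddCommGroup F]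
    (μ : Measure α) (f : α → F) :
    eLpNorm f 3 μ ^ (6 : ℝ) = (∫⁻ x, ‖f x‖ₑ ^ (3 : ℕ) ∂μ) ^ 2 := by
  rw [eLpNorm_three_rpow_eq μ f 6, show (6 : ℝ) / 3 = 2 by norm_num, ENNReal.rpow_two]

/-- `‖f‖₃⁶ = (‖f‖₃³)²`. -/
theorem eLpNorm_three_rpow_six_eq_sq {α F : Type*} [MeasurableSpace α] [NormedAddCommGroup F]
    (μ : Measure α) (f : α → F) :
    eLpNorm f 3 μ ^ (6 : ℝ) = (eLpNorm f 3 μ ^ (3 : ℝ)) ^ 2 := by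
  rw [eLpNorm_three_rpow_six_eq, eLpNorm_three_rpow_three_eq]

/-- **`t ↦ ‖u(t)‖₃³` is a.e.-measurable on `(0,T)`** for a classical solution on `[0,T)`: the velocity is
jointly continuous on the slab, so `(t,x) ↦ ‖u(t,x)‖ₑ³` is a.e.-measurable for the product measure and Tonelli
(`AEMeasurable.lintegral_prod_right'`) applies. -/
theorem aemeasurable_l3cube_of_frame {ν T : ℝ}
    {u : ℝ → (EuclideanSpace ℝ (Fin 3)) → (EuclideanSpace ℝ (Fin 3))} {p : ℝ → (EuclideanSpace ℝ (Fin 3)) → ℝ}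
    (hcl : IsClassicalNSSolutionOn (Ico 0 T) ν 0 u p) :
    AEMeasurable (fun t => eLpNorm (u t) 3 volume ^ (3 : ℝ)) (volume.restrict (Ioo 0 T)) := by
  set g : ℝ × (EuclideanSpace ℝ (Fin 3)) → ℝ≥0∞ := fun z => ‖u z.1 z.2‖ₑ ^ (3 : ℕ) with hg
  have hcont : ContinuousOn g (Ioo 0 T ×ˢ (univ : Set (EuclideanSpace ℝ (Fin 3)))) := by
    have h1 : ContinuousOn (uncurry u) (Ioo 0 T ×ˢ (univ : Set (EuclideanSpace ℝ (Fin 3)))) :=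
      hcl.smooth_velocity.continuousOn.mono (prod_mono Ioo_subset_Ico_self Subset.rfl)
    have h2 : Continuous fun v : EuclideanSpace ℝ (Fin 3) => ‖v‖ₑ ^ (3 : ℕ) :=
      (ENNReal.continuous_pow 3).comp continuous_enorm
    exact h2.comp_continuousOn h1
  have hprod : ((volume : Measure ℝ).restrict (Ioo 0 T)).prod (volume : Measure (EuclideanSpace ℝ (Fin 3))) =
      (volume : Measure (ℝ × (EuclideanSpace ℝ (Fin 3)))).restrict (Ioo 0 T ×ˢ univ) := by
    rw [Measure.restrict_prod_eq_prod_univ, ← Measure.volume_eq_prod]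
  have hgm : AEMeasurable g
      (((volume : Measure ℝ).restrict (Ioo 0 T)).prod (volume : Measure (EuclideanSpace ℝ (Fin 3)))) := by
    rw [hprod]
    exact hcont.aemeasurable (measurableSet_Ioo.prod MeasurableSet.univ)
  have h3 : AEMeasurable (fun t => ∫⁻ y, g (t, y)) (volume.restrict (Ioo 0 T)) := hgm.lintegral_prod_right'
  refine h3.congr (Eventually.of_forall fun t => ?_)
  simp only [hg]
  exact (eLpNorm_three_rpow_three_eq volume (u t)).symm

/-- The threshold `t ↦ A/√(T-t)` (as an extended real) is measurable. -/
theorem measurable_threshold (A T : ℝ) :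
    Measurable fun t : ℝ => ENNReal.ofReal (A / Real.sqrt (T - t)) :=
  (measurable_const.div ((measurable_const.sub measurable_id).sqrt)).ennreal_ofReal

/-- **The `L³`-fast set is null-measurable on `(T₂,T)`** (`0 ≤ T₂`) for a classical solution on `[0,T)`. -/
theorem nullMeasurableSet_fast_of_frame {ν T : ℝ}
    {u : ℝ → (EuclideanSpace ℝ (Fin 3)) → (EuclideanSpace ℝ (Fin 3))} {p : ℝ → (EuclideanSpace ℝ (Fin 3)) → ℝ}
    (hcl : IsClassicalNSSolutionOn (Ico 0 T) ν 0 u p) {T₂ : ℝ} (hT₂ : 0 ≤ T₂) (A : ℝ) :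
    NullMeasurableSet {t | ENNReal.ofReal (A / Real.sqrt (T - t)) < eLpNorm (u t) 3 volume ^ (3 : ℝ)}
      (volume.restrict (Ioo T₂ T)) := by
  have hle : volume.restrict (Ioo T₂ T) ≤ volume.restrict (Ioo 0 T) :=
    Measure.restrict_mono (Ioo_subset_Ioo_left hT₂) le_rfl
  exact nullMeasurableSet_lt (measurable_threshold A T).aemeasurable
    ((aemeasurable_l3cube_of_frame hcl).mono_measure hle)

/-! ## §1  Bookkeeping: the fast set against `∫ ‖u‖₃⁶` -/

/-- At a fast time, `A²/(T-t) < ‖u(t)‖₃⁶` (square both sides of `A/√(T-t) < ‖u(t)‖₃³`). -/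
theorem ofReal_sq_div_lt_rpow_six {x : ℝ≥0∞} {A s : ℝ} (hA : 0 ≤ A) (hs : 0 < s)
    (h : ENNReal.ofReal (A / Real.sqrt s) < x ^ (3 : ℝ)) : ENNReal.ofReal (A ^ 2 / s) < x ^ (6 : ℝ) := by
  have h1 : x ^ (6 : ℝ) = (x ^ (3 : ℝ)) ^ 2 := by
    rw [← ENNReal.rpow_two, ← ENNReal.rpow_mul]; norm_num
  have h2 : ENNReal.ofReal (A ^ 2 / s) = ENNReal.ofReal (A / Real.sqrt s) ^ 2 := by
    rw [← ENNReal.ofReal_pow (div_nonneg hA (Real.sqrt_nonneg _))]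
    congr 1
    rw [div_pow, Real.sq_sqrt hs.le]
  rw [h1, h2]
  exact ENNReal.pow_lt_pow_left two_ne_zero h

/-- **Bookkeeping inequality**: `∫_{(T₂,T)} 1_{fast} · A²/(T-t) dt ≤ ∫_{T₂}^{T} ‖u(t)‖₃⁶ dt`
(no hypothesis on `u`; lower Lebesgue integrals). -/
theorem lintegral_indicator_fast_le (u : ℝ → (EuclideanSpace ℝ (Fin 3)) → (EuclideanSpace ℝ (Fin 3)))
    (T T₂ : ℝ) {A : ℝ} (hA : 0 ≤ A) :
    ∫⁻ t in Ioo T₂ T, {t | ENNReal.ofReal (A / Real.sqrt (T - t)) < eLpNorm (u t) 3 volume ^ (3 : ℝ)}.indicator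
        (fun t => ENNReal.ofReal (A ^ 2 / (T - t))) t
      ≤ ∫⁻ t in Ioo T₂ T, eLpNorm (u t) 3 volume ^ (6 : ℝ) := by
  refine setLIntegral_mono' measurableSet_Ioo fun t ht => ?_
  by_cases hf : t ∈ {t | ENNReal.ofReal (A / Real.sqrt (T - t)) < eLpNorm (u t) 3 volume ^ (3 : ℝ)}
  · rw [indicator_of_mem hf]
    exact (ofReal_sq_div_lt_rpow_six hA (sub_pos.2 ht.2) hf).le
  · rw [indicator_of_notMem hf]
    exact bot_le

/-- The same with the logarithmic weight `(T-t)⁻¹`: `∫ 1_{fast}/(T-t) ≤ A⁻² ∫ ‖u‖₃⁶`. -/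
theorem lintegral_indicator_fast_inv_sub_le (u : ℝ → (EuclideanSpace ℝ (Fin 3)) → (EuclideanSpace ℝ (Fin 3)))
    (T T₂ : ℝ) {A : ℝ} (hA : 0 < A) :
    ∫⁻ t in Ioo T₂ T, {t | ENNReal.ofReal (A / Real.sqrt (T - t)) < eLpNorm (u t) 3 volume ^ (3 : ℝ)}.indicator
        (fun t => ENNReal.ofReal ((T - t)⁻¹)) t
      ≤ ENNReal.ofReal ((A ^ 2)⁻¹) * ∫⁻ t in Ioo T₂ T, eLpNorm (u t) 3 volume ^ (6 : ℝ) := by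
  have hA2 : 0 < A ^ 2 := pow_pos hA 2
  calc ∫⁻ t in Ioo T₂ T, {t | ENNReal.ofReal (A / Real.sqrt (T - t)) < eLpNorm (u t) 3 volume ^ (3 : ℝ)}.indicator
          (fun t => ENNReal.ofReal ((T - t)⁻¹)) t
      = ∫⁻ t in Ioo T₂ T, ENNReal.ofReal ((A ^ 2)⁻¹) *
          {t | ENNReal.ofReal (A / Real.sqrt (T - t)) < eLpNorm (u t) 3 volume ^ (3 : ℝ)}.indicator
            (fun t => ENNReal.ofReal (A ^ 2 / (T - t))) t := by
        refine setLIntegral_congr_fun measurableSet_Ioo fun t ht => ?_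
        by_cases hf : t ∈ {t | ENNReal.ofReal (A / Real.sqrt (T - t)) < eLpNorm (u t) 3 volume ^ (3 : ℝ)}
        · rw [indicator_of_mem hf, indicator_of_mem hf, ← ENNReal.ofReal_mul (inv_nonneg.2 hA2.le)]
          congr 1
          rw [div_eq_mul_inv, ← mul_assoc, inv_mul_cancel₀ hA2.ne', one_mul]
        · rw [indicator_of_notMem hf, indicator_of_notMem hf, mul_zero]
    _ = ENNReal.ofReal ((A ^ 2)⁻¹) * ∫⁻ t in Ioo T₂ T,
          {t | ENNReal.ofReal (A / Real.sqrt (T - t)) < eLpNorm (u t) 3 volume ^ (3 : ℝ)}.indicator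
            (fun t => ENNReal.ofReal (A ^ 2 / (T - t))) t :=
        lintegral_const_mul' _ _ ENNReal.ofReal_ne_top
    _ ≤ ENNReal.ofReal ((A ^ 2)⁻¹) * ∫⁻ t in Ioo T₂ T, eLpNorm (u t) 3 volume ^ (6 : ℝ) :=
        mul_le_mul_of_nonneg_left (lintegral_indicator_fast_le u T T₂ hA.le) bot_le

/-! ## §2  Log-nullity of the fast set on the full-Morrey class -/

/-- **The `L³`-fast set of a full-Morrey-Type-I frame solution is LOG-NULL**: for a classical solution on
`[0,T)`, Leray–Hopf, with `FullMorreyTypeINear u T`, and every `A > 0`, there is `T₂ ∈ (0,T)` with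
`∫_{(T₂,T)} 1_{‖u(t)‖₃³ > A/√(T-t)} dt/(T-t) < ∞` (THEOREM J′: `∫^{T}‖u‖₃⁶ < ∞`). -/
theorem lintegral_fast_inv_sub_lt_top_of_fullMorrey {ν T : ℝ} (hν : 0 < ν) (hT : 0 < T)
    {u : ℝ → (EuclideanSpace ℝ (Fin 3)) → (EuclideanSpace ℝ (Fin 3))} {p : ℝ → (EuclideanSpace ℝ (Fin 3)) → ℝ}
    (hcl : IsClassicalNSSolutionOn (Ico 0 T) ν 0 u p) (hLH : IsLerayHopfOn T ν 0 (u 0) u)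
    (hFM : FullMorreyTypeINear u T) {A : ℝ} (hA : 0 < A) :
    ∃ T₂ ∈ Ioo 0 T,
      (∀ t ∈ Ioo T₂ T, ENNReal.ofReal (A / Real.sqrt (T - t)) < eLpNorm (u t) 3 volume ^ (3 : ℝ) →
          ENNReal.ofReal (A ^ 2 / (T - t)) < eLpNorm (u t) 3 volume ^ (6 : ℝ)) ∧
      ∫⁻ t in Ioo T₂ T, {t | ENNReal.ofReal (A / Real.sqrt (T - t)) < eLpNorm (u t) 3 volume ^ (3 : ℝ)}.indicator
          (fun t => ENNReal.ofReal ((T - t)⁻¹)) t < ⊤ := by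
  obtain ⟨T₂, hT₂, -, -, -, h6⟩ := lintegral_six_lt_top_holds hν hT hcl hLH hFM
  refine ⟨T₂, hT₂, fun t ht hf => ofReal_sq_div_lt_rpow_six hA.le (sub_pos.2 ht.2) hf, ?_⟩
  exact lt_of_le_of_lt (lintegral_indicator_fast_inv_sub_le u T T₂ hA)
    (ENNReal.mul_lt_top ENNReal.ofReal_lt_top h6)

/-! ## §3  Density zero at `T` -/

/-- **Measure bookkeeping**: if the fast set is null-measurable on `(T₂,T)` and log-integrable there, then for
every `ε > 0` there is `h₀ > 0` with `|fast ∩ (T-h,T)| ≤ ε h` for all `0 < h < h₀` (absolute continuity of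
`s ↦ ∫_s 1_{fast}/(T-t)` plus `1 ≤ h/(T-t)` on `(T-h,T)`). -/
theorem density_zero_of_lintegral_indicator_inv_sub_lt_top {F : Set ℝ} {T T₂ : ℝ} (hT₂T : T₂ < T)
    (hF : NullMeasurableSet F (volume.restrict (Ioo T₂ T)))
    (hint : ∫⁻ t in Ioo T₂ T, F.indicator (fun t => ENNReal.ofReal ((T - t)⁻¹)) t < ⊤) :
    ∀ ε : ℝ, 0 < ε → ∃ h₀ : ℝ, 0 < h₀ ∧ ∀ h : ℝ, 0 < h → h < h₀ →
      volume (F ∩ Ioo (T - h) T) ≤ ENNReal.ofReal (ε * h) := by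
  intro ε hε
  set μ₂ : Measure ℝ := volume.restrict (Ioo T₂ T) with hμ₂
  set f : ℝ → ℝ≥0∞ := F.indicator (fun t => ENNReal.ofReal ((T - t)⁻¹)) with hf
  have hfin : ∫⁻ t, f t ∂μ₂ ≠ ⊤ := hint.ne
  obtain ⟨δ, hδ, hδf⟩ := exists_pos_setLIntegral_lt_of_measure_lt hfin (ENNReal.ofReal_pos.2 hε).ne'
  -- a finite positive `δ' ≤ δ`
  set δ' : ℝ≥0∞ := min δ 1 with hδ'
  have hδ'pos : 0 < δ' := lt_min hδ one_pos
  have hδ'top : δ' ≠ ⊤ := ne_top_of_le_ne_top ENNReal.one_ne_top (min_le_right _ _)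
  have hδ'real : 0 < δ'.toReal := ENNReal.toReal_pos hδ'pos.ne' hδ'top
  refine ⟨min (T - T₂) δ'.toReal, lt_min (sub_pos.2 hT₂T) hδ'real, fun h hh hhh => ?_⟩
  have hhT : h < T - T₂ := lt_of_lt_of_le hhh (min_le_left _ _)
  have hhδ : h < δ'.toReal := lt_of_lt_of_le hhh (min_le_right _ _)
  set J : Set ℝ := Ioo (T - h) T with hJ
  have hJmeas : MeasurableSet J := measurableSet_Ioo
  have hJsub : J ⊆ Ioo T₂ T := Ioo_subset_Ioo_left (by linarith)
  -- the measure of `J` under `μ₂` is `< δ`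
  have hμJ : μ₂ J < δ := by
    have h1 : μ₂ J ≤ volume J := Measure.restrict_apply_le _ _
    have h2 : volume J = ENNReal.ofReal h := by
      rw [hJ, Real.volume_Ioo]; congr 1; ring
    have h3 : ENNReal.ofReal h < δ' := by
      rw [← ENNReal.ofReal_toReal hδ'top]
      exact (ENNReal.ofReal_lt_ofReal_iff hδ'real).2 hhδ
    exact lt_of_le_of_lt (h1.trans h2.le) (lt_of_lt_of_le h3 (min_le_left _ _))
  have hsmall : ∫⁻ t in J, f t ∂μ₂ < ENNReal.ofReal ε := hδf J hμJ
  -- `volume (F ∩ J) = μ₂ (F ∩ J) = ∫ 1_{F ∩ J} dμ₂ ≤ ofReal h * ∫_J f dμ₂`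
  have hFJ : NullMeasurableSet (F ∩ J) μ₂ := hF.inter hJmeas.nullMeasurableSet
  have hvol : volume (F ∩ J) = μ₂ (F ∩ J) := by
    rw [hμ₂, Measure.restrict_eq_self _ ((inter_subset_right).trans hJsub)]
  have hpt : ∀ t, (F ∩ J).indicator (1 : ℝ → ℝ≥0∞) t ≤ ENNReal.ofReal h * J.indicator f t := by
    intro t
    by_cases ht : t ∈ F ∩ J
    · rw [indicator_of_mem ht, indicator_of_mem ht.2, hf, indicator_of_mem ht.1, Pi.one_apply,
        ← ENNReal.ofReal_mul hh.le]
      have hTt : 0 < T - t := sub_pos.2 ht.2.2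
      have hTth : T - t < h := by have := ht.2.1; linarith
      have h1 : (1 : ℝ) ≤ h * (T - t)⁻¹ := by
        rw [← div_eq_mul_inv, le_div_iff₀ hTt, one_mul]; exact hTth.le
      calc (1 : ℝ≥0∞) = ENNReal.ofReal 1 := ENNReal.ofReal_one.symm
        _ ≤ ENNReal.ofReal (h * (T - t)⁻¹) := ENNReal.ofReal_le_ofReal h1
    · rw [indicator_of_notMem ht]; exact bot_le
  calc volume (F ∩ J) = μ₂ (F ∩ J) := hvol
    _ = ∫⁻ t, (F ∩ J).indicator 1 t ∂μ₂ := (lintegral_indicator_one₀ hFJ).symm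
    _ ≤ ∫⁻ t, ENNReal.ofReal h * J.indicator f t ∂μ₂ := lintegral_mono hpt
    _ = ENNReal.ofReal h * ∫⁻ t, J.indicator f t ∂μ₂ := lintegral_const_mul' _ _ ENNReal.ofReal_ne_top
    _ = ENNReal.ofReal h * ∫⁻ t in J, f t ∂μ₂ := by rw [lintegral_indicator hJmeas]
    _ ≤ ENNReal.ofReal h * ENNReal.ofReal ε := mul_le_mul_of_nonneg_left hsmall.le bot_le
    _ = ENNReal.ofReal (ε * h) := by rw [← ENNReal.ofReal_mul hh.le, mul_comm]

/-- **The `L³`-fast set of a full-Morrey-Type-I frame solution has DENSITY ZERO at `T`**: for every `A > 0`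
and `ε > 0` there is `h₀ > 0` with `|{t ∈ (T-h,T) : ‖u(t)‖₃³ > A/√(T-t)}| ≤ ε h` for all `0 < h < h₀`. -/
theorem fastSet_density_zero_of_fullMorrey {ν T : ℝ} (hν : 0 < ν) (hT : 0 < T)
    {u : ℝ → (EuclideanSpace ℝ (Fin 3)) → (EuclideanSpace ℝ (Fin 3))} {p : ℝ → (EuclideanSpace ℝ (Fin 3)) → ℝ}
    (hcl : IsClassicalNSSolutionOn (Ico 0 T) ν 0 u p) (hLH : IsLerayHopfOn T ν 0 (u 0) u)
    (hFM : FullMorreyTypeINear u T) {A : ℝ} (hA : 0 < A) :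
    ∀ ε : ℝ, 0 < ε → ∃ h₀ : ℝ, 0 < h₀ ∧ ∀ h : ℝ, 0 < h → h < h₀ →
      volume ({t | ENNReal.ofReal (A / Real.sqrt (T - t)) < eLpNorm (u t) 3 volume ^ (3 : ℝ)} ∩ Ioo (T - h) T)
        ≤ ENNReal.ofReal (ε * h) := by
  obtain ⟨T₂, hT₂, -, hint⟩ := lintegral_fast_inv_sub_lt_top_of_fullMorrey hν hT hcl hLH hFM hA
  exact density_zero_of_lintegral_indicator_inv_sub_lt_top hT₂.2
    (nullMeasurableSet_fast_of_frame hcl hT₂.1.le A) hint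

/-! ## §4  The clause off the fast set, for every frame blow-up -/

/-- **Off the fast set the crux clause holds, for EVERY frame blow-up** (no Morrey hypothesis): by the landed
stub 1 (parabolic `L²` concentration, Kang–Miura–Tsai 2020 Thm 1.6(i)) and the one-time slow slice, for every
`A > 0` there are `m, R₀ > 0` and `T₁ < T` such that `FatClauseAt m R₀ 1 u T t` holds at every late time `t`
with `‖u(t)‖₃³ ≤ A/√(T-t)` (`m = γ/(A²c³)`, `R₀ = c/A`). -/
theorem fatClauseAt_offFast_of_blowup {ν T : ℝ} (hν : 0 < ν) (hT : 0 < T)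
    {u : ℝ → (EuclideanSpace ℝ (Fin 3)) → (EuclideanSpace ℝ (Fin 3))} {p : ℝ → (EuclideanSpace ℝ (Fin 3)) → ℝ}
    (hcl : IsClassicalNSSolutionOn (Ico 0 T) ν 0 u p) (hLH : IsLerayHopfOn T ν 0 (u 0) u)
    (hdec : HasRapidSpatialDecay (u 0)) (hnext : ¬ HasSmoothExtensionPast ν 0 u T) {A : ℝ} (hA : 0 < A) :
    ∃ m : ℝ, 0 < m ∧ ∃ R₀ : ℝ, 0 < R₀ ∧ ∃ T₁ < T, ∀ t ∈ Ioo T₁ T,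
      eLpNorm (u t) 3 volume ^ (3 : ℝ) ≤ ENNReal.ofReal (A / Real.sqrt (T - t)) → FatClauseAt m R₀ 1 u T t := by
  obtain ⟨γ, hγ, c, hc, T₁, hT₁, hPC⟩ := stub_parabolicConcentration_blowup ν T hν hT u p hcl hLH hdec hnext
  exact ⟨γ / (A ^ 2 * c ^ 3), by positivity, c / A, by positivity, T₁, hT₁,
    fun t ht hslow => fatClauseAt_of_parabolic_of_slow hγ hc hA ht.2 (hPC t ht) hslow⟩

/-! ## §5  Headline: `K₃(1)` at all late times outside a log-null set, on the full-Morrey class -/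

/-- **`K₃(1)` at MOST late times on the scaled-energy-Type-I class.**  A frame blow-up (classical on `[0,T)`,
Leray–Hopf from a rapidly decaying datum, no smooth extension past `T`) that is full-Morrey-Type-I near `T`
satisfies, for every threshold `A > 0`: there are constants `m, R₀ > 0` and `T₁ ∈ (0,T)` such that
(i) the `L³`-fast set `F = {t : ‖u(t)‖₃³ > A/√(T-t)}` is log-null on `(T₁,T)` (`∫_F dt/(T-t) < ∞`),
(ii) `F` has density zero at `T`, and (iii) the clause `FatClauseAt m R₀ 1 u T t` of `EffSatBlowup` holds at
every `t ∈ (T₁,T) ∖ F`. -/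
theorem effSat_mostTimes_of_fullMorrey {ν T : ℝ} (hν : 0 < ν) (hT : 0 < T)
    {u : ℝ → (EuclideanSpace ℝ (Fin 3)) → (EuclideanSpace ℝ (Fin 3))} {p : ℝ → (EuclideanSpace ℝ (Fin 3)) → ℝ}
    (hcl : IsClassicalNSSolutionOn (Ico 0 T) ν 0 u p) (hLH : IsLerayHopfOn T ν 0 (u 0) u)
    (hdec : HasRapidSpatialDecay (u 0)) (hnext : ¬ HasSmoothExtensionPast ν 0 u T)
    (hFM : FullMorreyTypeINear u T) {A : ℝ} (hA : 0 < A) :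
    ∃ m : ℝ, 0 < m ∧ ∃ R₀ : ℝ, 0 < R₀ ∧ ∃ T₁ ∈ Ioo 0 T,
      (∫⁻ t in Ioo T₁ T, {t | ENNReal.ofReal (A / Real.sqrt (T - t)) < eLpNorm (u t) 3 volume ^ (3 : ℝ)}.indicator
          (fun t => ENNReal.ofReal ((T - t)⁻¹)) t < ⊤) ∧
      (∀ ε : ℝ, 0 < ε → ∃ h₀ : ℝ, 0 < h₀ ∧ ∀ h : ℝ, 0 < h → h < h₀ →
        volume ({t | ENNReal.ofReal (A / Real.sqrt (T - t)) < eLpNorm (u t) 3 volume ^ (3 : ℝ)} ∩ Ioo (T - h) T)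
          ≤ ENNReal.ofReal (ε * h)) ∧
      ∀ t ∈ Ioo T₁ T,
        t ∉ {t | ENNReal.ofReal (A / Real.sqrt (T - t)) < eLpNorm (u t) 3 volume ^ (3 : ℝ)} →
          FatClauseAt m R₀ 1 u T t := by
  obtain ⟨T₂, hT₂, -, hint⟩ := lintegral_fast_inv_sub_lt_top_of_fullMorrey hν hT hcl hLH hFM hA
  obtain ⟨m, hm, R₀, hR₀, T₁, hT₁, hcl'⟩ := fatClauseAt_offFast_of_blowup hν hT hcl hLH hdec hnext hA
  have hdens := fastSet_density_zero_of_fullMorrey hν hT hcl hLH hFM hA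
  set T₃ : ℝ := max T₁ T₂ with hT₃
  have hT₃mem : T₃ ∈ Ioo 0 T := ⟨lt_max_of_lt_right hT₂.1, max_lt hT₁ hT₂.2⟩
  refine ⟨m, hm, R₀, hR₀, T₃, hT₃mem, ?_, hdens, fun t ht hnf => ?_⟩
  · exact lt_of_le_of_lt (lintegral_mono_set (Ioo_subset_Ioo_left (le_max_right _ _))) hint
  · have ht1 : t ∈ Ioo T₁ T := ⟨lt_of_le_of_lt (le_max_left _ _) ht.1, ht.2⟩
    exact hcl' t ht1 (not_lt.1 hnf)

/-! ## §6  Fast times are dissipation-fast on the full-Morrey class -/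

/-- **`L³`-fast ⇒ dissipation-fast on the full-Morrey class**: for a classical solution on `[0,T)`, Leray–Hopf,
full-Morrey-Type-I near `T`, there are `T₂ ∈ (0,T)` and `D < ∞` (the constant of J′'s slice inequality
`(∫|u(t)|³)² ≤ D · ∫|∇u(t)|²`) such that at every late time with `‖u(t)‖₃³ > A/√(T-t)` the dissipation rate
satisfies `A²/(T-t) < D · ∫|∇u(t)|²` — super-Leray dissipation (Leray's floor at a blow-up is `≳ (T-t)^{-1/2}`). -/
theorem dissip_fast_of_l3Fast_of_fullMorrey {ν T : ℝ} (hν : 0 < ν) (hT : 0 < T)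
    {u : ℝ → (EuclideanSpace ℝ (Fin 3)) → (EuclideanSpace ℝ (Fin 3))} {p : ℝ → (EuclideanSpace ℝ (Fin 3)) → ℝ}
    (hcl : IsClassicalNSSolutionOn (Ico 0 T) ν 0 u p) (hLH : IsLerayHopfOn T ν 0 (u 0) u)
    (hFM : FullMorreyTypeINear u T) {A : ℝ} (hA : 0 ≤ A) :
    ∃ T₂ ∈ Ioo 0 T, ∃ D : ℝ≥0∞, D ≠ ⊤ ∧ ∀ t ∈ Ioo T₂ T,
      ENNReal.ofReal (A / Real.sqrt (T - t)) < eLpNorm (u t) 3 volume ^ (3 : ℝ) →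
        ENNReal.ofReal (A ^ 2 / (T - t)) < D * dissipRate u t := by
  obtain ⟨T₂, hT₂, D, hDtop, hslice, -⟩ := lintegral_six_lt_top_holds hν hT hcl hLH hFM
  refine ⟨T₂, hT₂, D, hDtop, fun t ht hf => ?_⟩
  have h1 := ofReal_sq_div_lt_rpow_six hA (sub_pos.2 ht.2) hf
  rw [eLpNorm_three_rpow_six_eq] at h1
  exact lt_of_lt_of_le h1 (hslice t ht)

end Summit.NavierStokesRegularity.NavierStokesRegularity.Theorems.L3TimeExponentPincerFullMorreyMostTimes

end
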